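import Literature.Geometry.Kaehler.ComplexProjectiveSpaceFubiniStudy
import Literature.Geometry.Kaehler.ProjectiveAffineChartDeriv
import Literature.Geometry.Symplectic.OrigamiSphereProofs
import Mathlib.Analysis.Normed.Module.Connected
import HarnessLib

/-!
# Unfolding the origami 4-sphere, I: the blow-down map `β : S⁴ → ℂℙ²`, `(z₁, z₂, h) ↦ [z₁ : z₂ : h]`

Topic `Literature/Geometry/Symplectic`; companion of `OrigamiSphere.lean` / `OrigamiSphereProofs.lean`
(Cannas da Silva–Guillemin–Pires 2010, Example 2.3: `(S⁴, ω₀|)` is an origami manifold with fold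
the equator and null fibration the Hopf fibration). A. Cannas da Silva, V. Guillemin, A. R. Pires,
*Symplectic Origami*, IMRN 2011 = arXiv:0909.4065, **Example 2.6 / Prop. 2.8 (unfolding)**: cutting
the origami sphere `S²ⁿ ⊂ ℂⁿ × ℝ` along the equator produces `ℂℙⁿ` (twice); the collapsing map of
each closed hemisphere onto `ℂℙⁿ` is `(z, h) ↦ [z : h]` — a diffeomorphism of the open hemisphere
onto the affine chart `{Zₙ ≠ 0}`, the Hopf map `S²ⁿ⁻¹ → ℂℙⁿ⁻¹ = {Zₙ = 0}` on the equator, whose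
differential kills exactly the Hopf (null) direction there.

This file (`n = 2`) constructs the map and its DIFFERENTIAL, on the tree's real-charted `ℂℙ²`
(`Literature.Topology.FourManifolds.ComplexProjectivePlane`, charts `affineChart i` in
`EuclideanSpace ℝ (Fin 4)`; its Fubini–Study form is `CPn.fsForm 2`,
`Literature/Geometry/Kaehler/ComplexProjectiveSpaceFubiniStudy.lean`):

* `cplxCoord : ℝ⁵ →L[ℝ] ℂ³`, `(x₀, …, x₄) ↦ (x₀ + i x₁, x₂ + i x₃, x₄)` (so that the equator goes to the
  tree's line `ComplexProjectiveSpace.lineIncl = {Z₂ = 0}`);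
* `unfoldAux : ℝ⁵ → ComplexProjectivePlane`, `y ↦ [cplxCoord y]` (junk at `y = 0`), and the
  **blow-down map** `unfoldMap = unfoldAux ∘ Subtype.val : S⁴ → ComplexProjectivePlane`;
* `unfoldAux` is `C^∞` off the origin with derivative `L ∘ Dq ∘ cplxCoord`
  (`hasMFDerivAt_unfoldAux`; `Dq = qchartDeriv` from `ProjectiveAffineChartDeriv.lean`), hence
  `unfoldMap` is `C^∞` on all of `S⁴` (`contMDiff_unfoldMap`) and
  `dβ_x(v) = 0 ↔ cplxCoord (dι v) ∈ ℂ · cplxCoord x` (`mfderiv_unfoldMap_eq_zero_iff`), from which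
  the sequel `OrigamiSphereUnfolding.lean` reads off: `dβ_x` bijective for `h ≠ 0`, kernel the Hopf
  line for `h = 0`;
* the two sides of the fold: `upperHemisphere`, `lowerHemisphere : Opens S⁴` (`{h > 0}`, `{h < 0}`),
  disjoint and non-empty, with complement the equator `{h = 0} = range equatorIncl`, which is
  connected (`isConnected_compl_hemispheres`), and containing the frontiers of both sides.

## References

* [CannasdasilvaGuilleminPires2010] A. Cannas da Silva, V. Guillemin, A. R. Pires, *Symplectic
  Origami*, IMRN 2011 (18) 4252–4293 = arXiv:0909.4065, Example 2.3, Example 2.6, Prop. 2.8,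
  Def. 2.13 (radial blow-up), Prop. 2.26.
-/

noncomputable section

open scoped Manifold ContDiff Topology LinearAlgebra.Projectivization
open Set Function Module Projectivization
open Literature.NumberTheory.Transcendental Literature.AlgebraicGeometry.Motives.FubiniStudy
open Literature.Geometry.Kaehler Literature.Topology.FourManifolds
open Literature.Topology.FourManifolds.ComplexProjectiveSpace

namespace Literature.Geometry.Symplectic

/-- Local notation: `𝔼 n` is the model space `EuclideanSpace ℝ (Fin n)`. -/
local notation "𝔼" n:arg => EuclideanSpace ℝ (Fin n)

/-- Local notation: `𝕊⁴` is the unit sphere in `EuclideanSpace ℝ (Fin 5)`. -/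
local notation "𝕊⁴" => (Metric.sphere (0 : EuclideanSpace ℝ (Fin 5)) 1)

/-- The `Fact` feeding Mathlib's sphere API (`contMDiff_coe_sphere`, `range_mfderiv_coe_sphere`)
for `S⁴ ⊂ ℝ⁵`. [folklore] -/
theorem fact_finrank_euclideanSpace_five : Fact (finrank ℝ (𝔼 5) = 4 + 1) := ⟨finrank_euclideanSpace_fin⟩

attribute [local instance] fact_finrank_euclideanSpace_five

/-! ### `cplxCoord : ℝ⁵ → ℂ³` -/

/-- The real-linear identification `ℝ⁵ = ℂ² × ℝ → ℂ³`, `(x₀, x₁, x₂, x₃, x₄) ↦ (x₀ + i x₁, x₂ + i x₃,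
x₄)`: the coordinates `(z₁, z₂, h)` of Cannas da Silva–Guillemin–Pires, Example 2.3.
[cite: CannasdasilvaGuilleminPires2010, Example 2.3] -/
def cplxCoord : (𝔼 5) →L[ℝ] (Fin 3 → ℂ) :=
  LinearMap.toContinuousLinearMap
    { toFun := fun y ↦ ![⟨y 0, y 1⟩, ⟨y 2, y 3⟩, ((y 4 : ℝ) : ℂ)]
      map_add' := fun y y' ↦ by
        funext k
        fin_cases k <;> apply Complex.ext <;> simp
      map_smul' := fun c y ↦ by
        funext k
        fin_cases k <;> apply Complex.ext <;> simp }

/-- `(cplxCoord y)₀ = y₀ + i y₁`. [folklore] -/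
@[simp] theorem cplxCoord_apply_zero (y : 𝔼 5) : cplxCoord y 0 = ⟨y 0, y 1⟩ := rfl

/-- `(cplxCoord y)₁ = y₂ + i y₃`. [folklore] -/
@[simp] theorem cplxCoord_apply_one (y : 𝔼 5) : cplxCoord y 1 = ⟨y 2, y 3⟩ := rfl

/-- `(cplxCoord y)₂ = y₄` (real). [folklore] -/
@[simp] theorem cplxCoord_apply_two (y : 𝔼 5) : cplxCoord y 2 = ((y 4 : ℝ) : ℂ) := rfl

/-- `cplxCoord` is injective: `cplxCoord y = 0 ↔ y = 0`. [folklore] -/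
theorem cplxCoord_eq_zero_iff (y : 𝔼 5) : cplxCoord y = 0 ↔ y = 0 := by
  constructor
  · intro h
    have h0 := congrArg Complex.re (congrFun h 0)
    have h0' := congrArg Complex.im (congrFun h 0)
    have h1 := congrArg Complex.re (congrFun h 1)
    have h1' := congrArg Complex.im (congrFun h 1)
    have h2 := congrArg Complex.re (congrFun h 2)
    simp at h0 h0' h1 h1' h2
    ext i
    fin_cases i <;> simp [h0, h0', h1, h1', h2]
  · rintro rfl
    exact map_zero _

/-- On the unit sphere `cplxCoord x ≠ 0`. [folklore] -/
theorem cplxCoord_ne_zero (x : 𝕊⁴) : cplxCoord (x : 𝔼 5) ≠ 0 := by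
  intro h
  have hx : (x : 𝔼 5) = 0 := (cplxCoord_eq_zero_iff _).1 h
  have := norm_eq_of_mem_sphere x
  rw [hx, norm_zero] at this
  exact zero_ne_one this

/-- **Real multiples.** If `cplxCoord V = a • cplxCoord X` with `X₄ ≠ 0`, then `a` is real and
`V = (re a) • X` (compare the real coordinate `h`). [folklore] -/
theorem eq_smul_of_cplxCoord_eq_smul {V X : 𝔼 5} {a : ℂ} (hX : X 4 ≠ 0)
    (h : cplxCoord V = a • cplxCoord X) : V = a.re • X := by
  have h0 := congrFun h 0
  have h1 := congrFun h 1
  have h2 := congrFun h 2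
  simp only [cplxCoord_apply_zero, cplxCoord_apply_one, cplxCoord_apply_two, Pi.smul_apply,
    smul_eq_mul] at h0 h1 h2
  have him : a.im = 0 := by
    have := congrArg Complex.im h2
    simp at this
    rcases this with h | h
    · exact h
    · exact absurd h hX
  have e0 := congrArg Complex.re h0
  have e0' := congrArg Complex.im h0
  have e1 := congrArg Complex.re h1
  have e1' := congrArg Complex.im h1
  have e2 := congrArg Complex.re h2
  simp [him] at e0 e0' e1 e1' e2
  ext i
  fin_cases i <;> simp [e0, e0', e1, e1', e2]

/-- **The Hopf direction.** On `{x₄ = 0}`, multiplication by `i` on `cplxCoord` is the tree's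
`rotFive` (`(x₀, …, x₃, 0) ↦ (-x₁, x₀, -x₃, x₂, 0)`). [folklore] -/
theorem cplxCoord_rotFive {X : 𝔼 5} (hX : X 4 = 0) :
    cplxCoord (rotFive X) = Complex.I • cplxCoord X := by
  funext k
  fin_cases k <;> apply Complex.ext <;> simp [rotFive, hX]

/-- On `{x₄ = 0}`: `cplxCoord V = a • cplxCoord X ↔ V = (re a) • X + (im a) • rotFive X`.
[folklore] -/
theorem cplxCoord_eq_smul_iff {V X : 𝔼 5} {a : ℂ} (hX : X 4 = 0) :
    cplxCoord V = a • cplxCoord X ↔ V = a.re • X + a.im • rotFive X := by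
  constructor
  · intro h
    have h0 := congrFun h 0
    have h1 := congrFun h 1
    have h2 := congrFun h 2
    simp only [cplxCoord_apply_zero, cplxCoord_apply_one, cplxCoord_apply_two, Pi.smul_apply,
      smul_eq_mul] at h0 h1 h2
    have e0 := congrArg Complex.re h0
    have e0' := congrArg Complex.im h0
    have e1 := congrArg Complex.re h1
    have e1' := congrArg Complex.im h1
    have e2 := congrArg Complex.re h2
    simp [hX] at e0 e0' e1 e1' e2
    ext i
    fin_cases i <;> simp [rotFive, hX, e0, e0', e1, e1', e2] <;> ring
  · intro h
    rw [h]
    funext k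
    fin_cases k <;> apply Complex.ext <;> simp [rotFive, hX] <;> ring

/-! ### The blow-down map -/

/-- The map `ℝ⁵ → ℂℙ²`, `y ↦ [cplxCoord y] = [z₁ : z₂ : h]` (junk value `[1 : 1 : 1]` at `y = 0`).
[cite: CannasdasilvaGuilleminPires2010, Example 2.6] -/
def unfoldAux (y : 𝔼 5) : ComplexProjectivePlane :=
  if h : cplxCoord y = 0 then ComplexProjectiveSpace.mk ⟨fun _ ↦ 1, by simp [funext_iff]⟩
  else ComplexProjectiveSpace.mk ⟨cplxCoord y, h⟩

/-- Off the origin, `unfoldAux y = [cplxCoord y]`. [folklore] -/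
theorem unfoldAux_of_ne {y : 𝔼 5} (hy : cplxCoord y ≠ 0) :
    unfoldAux y = ComplexProjectiveSpace.mk ⟨cplxCoord y, hy⟩ :=
  dif_neg hy

/-- **The blow-down (unfolding) map of the origami sphere**, `β : S⁴ → ℂℙ²`,
`(z₁, z₂, h) ↦ [z₁ : z₂ : h]` (Cannas da Silva–Guillemin–Pires 2010, Example 2.6 / Prop. 2.8 /
Def. 2.13: the collapse of each closed hemisphere onto `ℂℙ²`, the Hopf map on the equator).
[cite: CannasdasilvaGuilleminPires2010, Example 2.6] -/
def unfoldMap : 𝕊⁴ → ComplexProjectivePlane := unfoldAux ∘ Subtype.val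

/-- `β x = [cplxCoord x]`. [folklore] -/
theorem unfoldMap_eq_mk (x : 𝕊⁴) :
    unfoldMap x = ComplexProjectiveSpace.mk ⟨cplxCoord (x : 𝔼 5), cplxCoord_ne_zero x⟩ := by
  simp only [unfoldMap, comp_apply, unfoldAux_of_ne (cplxCoord_ne_zero x)]

/-- `unfoldAux` is continuous off the origin (it is `[·] ∘ cplxCoord` there). [folklore] -/
theorem continuousAt_unfoldAux {y : 𝔼 5} (hy : cplxCoord y ≠ 0) : ContinuousAt unfoldAux y := by
  have hU : IsOpen {y' : 𝔼 5 | cplxCoord y' ≠ 0} := isOpen_ne_fun cplxCoord.continuous continuous_const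
  have hcont : ContinuousOn unfoldAux {y' : 𝔼 5 | cplxCoord y' ≠ 0} := by
    rw [continuousOn_iff_continuous_restrict]
    have : ({y' : 𝔼 5 | cplxCoord y' ≠ 0}).restrict unfoldAux =
        (ComplexProjectiveSpace.mk : {v : Fin 3 → ℂ // v ≠ 0} → ComplexProjectivePlane) ∘
          fun y' ↦ ⟨cplxCoord y'.1, y'.2⟩ := by
      funext y'
      exact unfoldAux_of_ne y'.2
    rw [this]
    exact ComplexProjectiveSpace.continuous_mk.comp
      (Continuous.subtype_mk (cplxCoord.continuous.comp continuous_subtype_val) _)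
  exact hcont.continuousAt (hU.mem_nhds hy)

/-- Near a point off the origin, the `c`-th affine coordinates of `unfoldAux` are
`qchart c ∘ cplxCoord`. [folklore] -/
theorem affineCoordComplex_unfoldAux_eventuallyEq {y : 𝔼 5} (hy : cplxCoord y ≠ 0) (c : Fin 3) :
    (fun y' ↦ affineCoordComplex c (unfoldAux y')) =ᶠ[𝓝 y] fun y' ↦ qchart c (cplxCoord y') := by
  have hU : IsOpen {y' : 𝔼 5 | cplxCoord y' ≠ 0} := isOpen_ne_fun cplxCoord.continuous continuous_const
  filter_upwards [hU.mem_nhds hy] with y' hy'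
  rw [unfoldAux_of_ne hy', affineCoordComplex_mk]
  rfl

/-- **`unfoldAux` is `C^∞` off the origin**: in the affine chart `U_c` (`c = chartIndex [cplxCoord y]`) its
coordinates are `qchart c ∘ cplxCoord`, a quotient of linear functions with non-vanishing
denominator. [cite: CannasdasilvaGuilleminPires2010, Example 2.6] -/
theorem contMDiffAt_unfoldAux {y : 𝔼 5} (hy : cplxCoord y ≠ 0) :
    ContMDiffAt 𝓘(ℝ, 𝔼 5) (𝓡 4) ∞ unfoldAux y := by
  set c : Fin 3 := chartIndex (unfoldAux y) with hc
  have hyc : CoordNeZero c (unfoldAux y) := coordNeZero_chartIndex _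
  have hcne : cplxCoord y c ≠ 0 := by
    have h : CoordNeZero c (unfoldAux y) := hyc
    rwa [unfoldAux_of_ne hy, coordNeZero_mk] at h
  refine (CPn.contMDiffAt_iff_affineChart (I' := 𝓘(ℝ, 𝔼 5)) (n := 2) c hyc).2 ⟨continuousAt_unfoldAux hy, ?_⟩
  refine ContMDiffAt.congr_of_eventuallyEq ?_ (affineCoordComplex_unfoldAux_eventuallyEq hy c)
  exact ((((contDiffAt_qchart c hcne (k := ∞)).restrict_scalars ℝ)).comp y
    cplxCoord.contDiff.contDiffAt).contMDiffAt

/-- **The blow-down map is `C^∞` on all of `S⁴`.** [cite: CannasdasilvaGuilleminPires2010, Prop. 2.8] -/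
theorem contMDiff_unfoldMap : ContMDiff (𝓡 4) (𝓡 4) ∞ unfoldMap := fun x ↦
  (contMDiffAt_unfoldAux (cplxCoord_ne_zero x)).comp x (contMDiff_coe_sphere (E := 𝔼 5) (n := 4) x)

/-- **The differential of `unfoldAux`** at `y ≠ 0`: `L ∘ Dq_c(cplxCoord y) ∘ cplxCoord`, where
`c = chartIndex [cplxCoord y]` is the preferred chart index and `Dq_c = qchartDeriv c` the derivative of the
affine chart map (`hasFDerivAt_qchart`). [cite: CannasdasilvaGuilleminPires2010, Example 2.6] -/
theorem hasMFDerivAt_unfoldAux {y : 𝔼 5} (hy : cplxCoord y ≠ 0) :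
    HasMFDerivAt 𝓘(ℝ, 𝔼 5) (𝓡 4) unfoldAux y
      ((realCoordinates 2 : (Fin 2 → ℂ) →L[ℝ] 𝔼 (2 * 2)) ∘L
        ((qchartDeriv (chartIndex (unfoldAux y)) (cplxCoord y)).restrictScalars ℝ) ∘L cplxCoord) := by
  set c : Fin 3 := chartIndex (unfoldAux y) with hc
  have hcne : cplxCoord y c ≠ 0 := by
    have h : CoordNeZero c (unfoldAux y) := coordNeZero_chartIndex _
    rwa [unfoldAux_of_ne hy, coordNeZero_mk] at h
  refine ⟨continuousAt_unfoldAux hy, ?_⟩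
  have hwr : writtenInExtChartAt 𝓘(ℝ, 𝔼 5) (𝓡 4) y unfoldAux =
      fun y' ↦ realCoordinates 2 (affineCoordComplex c (unfoldAux y')) := rfl
  rw [hwr, extChartAt_self_apply, modelWithCornersSelf_coe, range_id, hasFDerivWithinAt_univ]
  have hev : (fun y' ↦ realCoordinates 2 (affineCoordComplex c (unfoldAux y'))) =ᶠ[𝓝 y]
      fun y' ↦ realCoordinates 2 (qchart c (cplxCoord y')) := by
    filter_upwards [affineCoordComplex_unfoldAux_eventuallyEq hy c] with y' hy'
    rw [hy']
  refine HasFDerivAt.congr_of_eventuallyEq ?_ hev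
  exact (realCoordinates 2).hasFDerivAt.comp y
    (((hasFDerivAt_qchart c hcne).restrictScalars ℝ).comp y cplxCoord.hasFDerivAt)

/-- **The differential of the blow-down map**:
`dβ_x(v) = L (Dq_c(cplxCoord x) (cplxCoord (dι_x v)))`, `ι : S⁴ ↪ ℝ⁵` the inclusion.
[cite: CannasdasilvaGuilleminPires2010, Example 2.6] -/
theorem mfderiv_unfoldMap_apply (x : 𝕊⁴) (v : TangentSpace (𝓡 4) x) :
    mfderiv (𝓡 4) (𝓡 4) unfoldMap x v =
      realCoordinates 2 (qchartDeriv (chartIndex (unfoldMap x)) (cplxCoord (x : 𝔼 5))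
        (cplxCoord (mfderiv (𝓡 4) 𝓘(ℝ, 𝔼 5) (Subtype.val : 𝕊⁴ → 𝔼 5) x v))) := by
  have hB := hasMFDerivAt_unfoldAux (cplxCoord_ne_zero x)
  have hval : MDifferentiableAt (𝓡 4) 𝓘(ℝ, 𝔼 5) (Subtype.val : 𝕊⁴ → 𝔼 5) x :=
    (contMDiff_coe_sphere (E := 𝔼 5) (n := 4) x).mdifferentiableAt one_ne_zero
  rw [unfoldMap, mfderiv_comp x hB.mdifferentiableAt hval, hB.mfderiv]
  rfl

/-- **Kernel of the differential of the blow-down map**: `dβ_x(v) = 0` iff `cplxCoord (dι_x v)` lies on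
the complex line through `cplxCoord x` (`L` is injective and the kernel of `Dq_c(w)` is `ℂ w`,
`qchartDeriv_eq_zero_iff`). [cite: CannasdasilvaGuilleminPires2010, Example 2.6] -/
theorem mfderiv_unfoldMap_eq_zero_iff (x : 𝕊⁴) (v : TangentSpace (𝓡 4) x) :
    mfderiv (𝓡 4) (𝓡 4) unfoldMap x v = 0 ↔
      ∃ a : ℂ, cplxCoord (mfderiv (𝓡 4) 𝓘(ℝ, 𝔼 5) (Subtype.val : 𝕊⁴ → 𝔼 5) x v) =
        a • cplxCoord (x : 𝔼 5) := by
  set c : Fin 3 := chartIndex (unfoldMap x) with hc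
  have hcne : cplxCoord (x : 𝔼 5) c ≠ 0 := by
    have h : CoordNeZero c (unfoldMap x) := coordNeZero_chartIndex _
    rwa [unfoldMap_eq_mk, coordNeZero_mk] at h
  rw [mfderiv_unfoldMap_apply, ← qchartDeriv_eq_zero_iff _ hcne]
  constructor
  · intro h
    have h' : (realCoordinates 2 (qchartDeriv c (cplxCoord (x : 𝔼 5))
        (cplxCoord (mfderiv (𝓡 4) 𝓘(ℝ, 𝔼 5) (Subtype.val : 𝕊⁴ → 𝔼 5) x v))) : 𝔼 (2 * 2)) =
        (0 : 𝔼 (2 * 2)) := h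
    have := congrArg (realCoordinates 2).symm h'
    simpa using this
  · intro h
    rw [h, map_zero]
    rfl

/-! ### The hemispheres -/

/-- The height `h = x₄` is continuous on `S⁴`. [folklore] -/
theorem continuous_height : Continuous fun x : 𝕊⁴ ↦ (x : 𝔼 5) 4 :=
  (EuclideanSpace.proj (4 : Fin 5)).continuous.comp continuous_subtype_val

/-- The open upper hemisphere `V₊ = {h > 0}`. [cite: CannasdasilvaGuilleminPires2010, Example 2.6] -/
def upperHemisphere : TopologicalSpace.Opens 𝕊⁴ :=
  ⟨{x | 0 < (x : 𝔼 5) 4}, isOpen_lt continuous_const continuous_height⟩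

/-- The open lower hemisphere `V₋ = {h < 0}`. [cite: CannasdasilvaGuilleminPires2010, Example 2.6] -/
def lowerHemisphere : TopologicalSpace.Opens 𝕊⁴ :=
  ⟨{x | (x : 𝔼 5) 4 < 0}, isOpen_lt continuous_height continuous_const⟩

/-- Membership in `V₊`. [folklore] -/
@[simp] theorem mem_upperHemisphere (x : 𝕊⁴) : x ∈ upperHemisphere ↔ 0 < (x : 𝔼 5) 4 := Iff.rfl
/-- Membership in `V₋`. [folklore] -/
@[simp] theorem mem_lowerHemisphere (x : 𝕊⁴) : x ∈ lowerHemisphere ↔ (x : 𝔼 5) 4 < 0 := Iff.rfl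

/-- `V₊` as a set. [folklore] -/
theorem coe_upperHemisphere : (upperHemisphere : Set 𝕊⁴) = {x : 𝕊⁴ | 0 < (x : 𝔼 5) 4} := rfl
/-- `V₋` as a set. [folklore] -/
theorem coe_lowerHemisphere : (lowerHemisphere : Set 𝕊⁴) = {x : 𝕊⁴ | (x : 𝔼 5) 4 < 0} := rfl

/-- The hemispheres are disjoint. [folklore] -/
theorem disjoint_hemispheres : Disjoint upperHemisphere lowerHemisphere := by
  rw [disjoint_iff_inf_le]
  rintro x ⟨h1, h2⟩
  rw [SetLike.mem_coe, mem_upperHemisphere] at h1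
  rw [SetLike.mem_coe, mem_lowerHemisphere] at h2
  exact (lt_asymm h1 h2).elim

/-- The north pole `(0, 0, 0, 0, 1)`. [folklore] -/
def northPole : 𝕊⁴ := ⟨EuclideanSpace.single (4 : Fin 5) (1 : ℝ), by simp⟩

/-- The north pole lies in `V₊`. [folklore] -/
theorem northPole_mem_upperHemisphere : northPole ∈ upperHemisphere := by
  simp [northPole]

/-- The south pole lies in `V₋`. [folklore] -/
theorem neg_northPole_mem_lowerHemisphere : -northPole ∈ lowerHemisphere := by
  simp [northPole]

/-- The complement of `V₊ ∪ V₋` is the equator `{h = 0}`. [folklore] -/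
theorem compl_union_hemispheres :
    ((upperHemisphere : Set 𝕊⁴) ∪ (lowerHemisphere : Set 𝕊⁴))ᶜ = {x : 𝕊⁴ | (x : 𝔼 5) 4 = 0} := by
  ext x
  simp only [coe_upperHemisphere, coe_lowerHemisphere, mem_compl_iff, mem_union, mem_setOf_eq,
    not_or, not_lt]
  constructor
  · rintro ⟨h1, h2⟩
    exact le_antisymm h1 h2
  · intro h
    simp [h]

/-- The complement of `V₊ ∪ V₋` is the image of the equator embedding `S³ ↪ S⁴`. [folklore] -/
theorem compl_union_hemispheres_eq_range :
    ((upperHemisphere : Set 𝕊⁴) ∪ (lowerHemisphere : Set 𝕊⁴))ᶜ = range equatorIncl := by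
  rw [compl_union_hemispheres, range_equatorIncl]

/-- **The fold `Z = {h = 0}` is connected** (it is the image of `S³`).
[cite: CannasdasilvaGuilleminPires2010, Example 2.3] -/
theorem isConnected_compl_hemispheres :
    IsConnected ((upperHemisphere : Set 𝕊⁴) ∪ (lowerHemisphere : Set 𝕊⁴))ᶜ := by
  rw [compl_union_hemispheres_eq_range]
  -- `S³` is connected (`isConnected_sphere` in `ℝ⁴`, `1 < dim`; cf. the tree's
  -- `Literature.Topology.FourManifolds.connectedSpace_sphere_three`, not imported to keep Cerf theory
  -- out of the import closure)
  haveI : ConnectedSpace (Metric.sphere (0 : EuclideanSpace ℝ (Fin 4)) 1) :=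
    isConnected_iff_connectedSpace.mp (isConnected_sphere
      (by rw [← Module.finrank_eq_rank, finrank_euclideanSpace_fin]; norm_num) 0 zero_le_one)
  exact isConnected_range contMDiff_equatorIncl.continuous

/-- The frontier of `V₊` lies in the equator. [folklore] -/
theorem frontier_upperHemisphere_subset :
    frontier (upperHemisphere : Set 𝕊⁴) ⊆ {x : 𝕊⁴ | (x : 𝔼 5) 4 = 0} := fun _ hx ↦
  Eq.symm (frontier_lt_subset_eq continuous_const continuous_height hx)

/-- The frontier of `V₋` lies in the equator. [folklore] -/
theorem frontier_lowerHemisphere_subset :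
    frontier (lowerHemisphere : Set 𝕊⁴) ⊆ {x : 𝕊⁴ | (x : 𝔼 5) 4 = 0} := fun _ hx ↦
  frontier_lt_subset_eq continuous_height continuous_const hx

end Literature.Geometry.Symplectic
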